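import Mathlib

/-!
# T5CoprimeCompositum — N2.8.2(c): `F⁺_w ⊗ K₂` is a field iff `2` is non-split in `K`

Kernel witness (cell pub-hodge-repro2, seat p3, Tier-5 support for sub-step N2) for the one-line
[A] of route/T5-N2-route-3.md §N2.8.2(c):

«(iv) for g₂ = 1: F⁺_w ⊗ K_2 is a field ⟺ 2 is non-split in K, because the unramified cubic
extension of ℚ₂ and a quadratic extension of ℚ₂ are linearly disjoint (coprime degrees) and a
split K_2 = ℚ₂ × ℚ₂ splits the tensor product ✓; … and «w non-split in E» is constant on the
Gal(F⁺/ℚ)-orbit of dyadic places since every σ ∈ Gal(F⁺/ℚ) extends to E (E/ℚ Galois) ✓».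

What is kernel-checked here (Mathlib only; nothing beyond Mathlib's field theory):

* `isField_tensor_of_coprime`: an intermediate field `A` of `E / F` of finite degree and a field
  `L` with `F ⊆ L ⊆ E` of degree coprime to `[A : F]` are linearly disjoint (Mathlib:
  `IntermediateField.LinearDisjoint.of_finrank_coprime`), hence `A ⊗[F] L` is a field
  (`IntermediateField.LinearDisjoint.isField_of_isAlgebraic`).
* `isField_tensor_of_finrank_three_two`: the degrees of the line, `[A : F] = 3` (the unramified
  cubic `F⁺_w`) and `[L : F] = 2` (a quadratic field `K₂`), both inside a fixed algebraic closure
  `E` of `F = ℚ₂`.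
* `not_isField_prod`, `not_isField_tensor_prod`, `not_isField_tensor_of_split`: a split quadratic
  algebra `L ≃ₐ[F] F × F` makes `A ⊗[F] L ≃ₐ[F] (A ⊗[F] F) × (A ⊗[F] F)` a product of two
  non-trivial rings, which is never a field («a split K_2 = ℚ₂ × ℚ₂ splits the tensor product»).
* `exists_extension_of_normal`: every `F`-automorphism of a subextension `K₁` of a normal
  extension `E / F` extends to an `F`-automorphism of `E` (Mathlib `AlgEquiv.liftNormal`) — the
  clause «every σ ∈ Gal(F⁺/ℚ) extends to E (E/ℚ Galois)».
* `eq_empty_or_univ_of_smul_stable`: a subset of a transitive `G`-set that is stable under `G` is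
  empty or everything — the shape of «D = ∅ or D = all» once the dyadic places of `F⁺` are known
  to form one `Gal(F⁺/ℚ)`-orbit.

What stays prose (labels unchanged): that `F⁺_w` IS the unramified cubic extension of `ℚ₂` when
`g₂ = 1` (N2.8.2(b)); that `K ⊗_ℚ ℚ₂` is a field exactly when `2` is non-split in `K` (the
definition of «non-split» read through the completion); and the transitivity of `Gal(F⁺/ℚ)` on the
dyadic places of `F⁺`.

README §8(d): this file uses an L-value-free non-vanishing device: NO.
-/

namespace Summit.Ventures.HodgeRepro2.T5CoprimeCompositum

open Module TensorProduct

section Coprime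

variable {F E : Type*} [Field F] [Field E] [Algebra F E]

/-- N2.8.2(c), first clause: an intermediate field `A` of `E / F` of finite degree and a field `L`,
`F ⊆ L ⊆ E`, of degree coprime to `[A : F]` are linearly disjoint over `F` (Mathlib), hence
`A ⊗[F] L` is a field. -/
theorem isField_tensor_of_coprime (A : IntermediateField F E) (L : Type*) [Field L] [Algebra F L]
    [Algebra L E] [IsScalarTower F L E] [FiniteDimensional F A]
    (H : (finrank F A).Coprime (finrank F L)) : IsField (A ⊗[F] L) :=
  (IntermediateField.LinearDisjoint.of_finrank_coprime H).isField_of_isAlgebraic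
    (Or.inl inferInstance)

/-- The degrees of the line: `[F⁺_w : ℚ₂] = 3` (the unramified cubic) and `[K₂ : ℚ₂] = 2`
(a quadratic field), both inside one algebraic closure `E` of `F = ℚ₂`: the tensor product is a
field. -/
theorem isField_tensor_of_finrank_three_two (A : IntermediateField F E) (L : Type*) [Field L]
    [Algebra F L] [Algebra L E] [IsScalarTower F L E]
    (hA : finrank F A = 3) (hL : finrank F L = 2) : IsField (A ⊗[F] L) := by
  haveI : FiniteDimensional F A := Module.finite_of_finrank_pos (by omega)
  exact isField_tensor_of_coprime A L (by rw [hA, hL]; decide)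

end Coprime

section Split

/-- A product of two non-trivial semirings is not a field: `(1, 0)` has no inverse. -/
theorem not_isField_prod (X Y : Type*) [Semiring X] [Semiring Y] [Nontrivial X] [Nontrivial Y] :
    ¬ IsField (X × Y) := by
  intro h
  obtain ⟨b, hb⟩ := h.mul_inv_cancel (a := ((1 : X), (0 : Y))) (by simp)
  have h2 := congrArg Prod.snd hb
  simp at h2

variable {F : Type*} [Field F] (A : Type*) [Ring A] [Algebra F A] [Nontrivial A]

/-- `A ⊗[F] (F × F) ≃ₐ[F] (A ⊗[F] F) × (A ⊗[F] F)` is not a field. -/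
theorem not_isField_tensor_prod : ¬ IsField (A ⊗[F] (F × F)) := by
  intro h
  haveI : Nontrivial (A ⊗[F] F) := (Algebra.TensorProduct.rid F F A).toEquiv.nontrivial
  exact not_isField_prod (A ⊗[F] F) (A ⊗[F] F)
    ((Algebra.TensorProduct.prodRight F F A F F).symm.toMulEquiv.isField h)

/-- The split case of the line: if the quadratic algebra `L` is split, `L ≃ₐ[F] F × F`, then
`A ⊗[F] L` is not a field. -/
theorem not_isField_tensor_of_split (L : Type*) [Ring L] [Algebra F L] (e : L ≃ₐ[F] F × F) :
    ¬ IsField (A ⊗[F] L) := fun h =>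
  not_isField_tensor_prod A
    ((Algebra.TensorProduct.congr (AlgEquiv.refl : A ≃ₐ[F] A) e).symm.toMulEquiv.isField h)

end Split

section Galois

variable {F E K₁ : Type*} [Field F] [Field E] [Field K₁] [Algebra F E] [Algebra F K₁]
  [Algebra K₁ E] [IsScalarTower F K₁ E]

/-- «Every σ ∈ Gal(F⁺/ℚ) extends to E (E/ℚ Galois)»: for a normal extension `E / F` and a
subextension `K₁`, every `F`-automorphism `σ` of `K₁` is the restriction of an `F`-automorphism
`τ` of `E` (Mathlib `AlgEquiv.liftNormal`). -/
theorem exists_extension_of_normal [Normal F E] (σ : K₁ ≃ₐ[F] K₁) :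
    ∃ τ : E ≃ₐ[F] E, ∀ x : K₁, τ (algebraMap K₁ E x) = algebraMap K₁ E (σ x) :=
  ⟨σ.liftNormal E, fun x => σ.liftNormal_commutes E x⟩

end Galois

section Orbit

/-- «D = ∅ or D = all»: a subset of a transitive `G`-set that is stable under `G` is empty or
everything. -/
theorem eq_empty_or_univ_of_smul_stable {G X : Type*} [Group G] [MulAction G X]
    [MulAction.IsPretransitive G X] (D : Set X) (hD : ∀ g : G, ∀ x ∈ D, g • x ∈ D) :
    D = ∅ ∨ D = Set.univ := by
  rcases D.eq_empty_or_nonempty with h | ⟨x, hx⟩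
  · exact Or.inl h
  · refine Or.inr (Set.eq_univ_of_forall fun y => ?_)
    obtain ⟨g, rfl⟩ := MulAction.exists_smul_eq G x y
    exact hD g x hx

end Orbit

end Summit.Ventures.HodgeRepro2.T5CoprimeCompositum
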